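/-
Copyright (c) 2026 the pub-hodgecm-mathlib formalisation cell (harness21).  Prover seat hodgecm-mathlib-K2Liu-p11 (g2), Track B «K2-LIT»,
#184♮ = hLiu418 = `stmt-HodgeConjecture-24832`; organ S2, LEAD F0P6-plan (g14) RULING M-158g (road (γ), (J-ii)): the TENSOR INDUCTION over the places.
THEOREMS ONLY (no `def`, no `instance`, no notation, no named-fact hypothesis, no `sorry`); GENERIC linear algebra in a commutative ℂ-algebra.
-/
import Mathlib.Algebra.Algebra.Basic
import Mathlib.Algebra.BigOperators.Group.Finset.Basic
import Mathlib.LinearAlgebra.Span.Basic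
import Mathlib.Data.Complex.Basic
import Mathlib.Data.Fintype.Basic
import HarnessLib

/-!
# Crux `HLiu418`, S2-asm road (γ), (J-ii): SLOT-WISE SUBMODULE INDUCTION — a submodule of the multi-place carrier stable under every slot operator and containing the
# anchor pure tensors contains `⊗_w R_w` (all products of one-place generated vectors)

Cell `hodgecm-mathlib`, crux item hLiu418 = `stmt-HodgeConjecture-24832` (helper lane `--supports`, count-neutral).

CURRENCY (M-158g; census 13:41Z): the multi-place compact-picture carrier is ONE commutative ℂ-algebra `R` (e.g. `ℂ[X_{ij,w}][∏_w D_w⁻¹]`); each place `i` has a one-place space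
`A i` (★ `Carrier = Localization.Away detPoly`), a ℂ-linear slot map `φ i : A i →ₗ[ℂ] R`, a set `Ops₀ i` of one-place operators (★ `pOp ∕ mOp ∕ lOp ∕ rOp`, generic over the ring),
a finite ANCHOR family `a i : κ i → A i` (p10's two Gaussian K-types per place) and the one-place generated submodule `Rw i ≤ A i` (★ K-2c ∕ `forall_kType_le_of_anchors`:
«every `Ops₀ i`-stable submodule containing the anchors contains `Rw i`» — BINDER (gen)).  «Pure tensor» = the product `∏ i, φ i (r i)` in `R`.
BINDER (slot) («★ FILE 1 read at one place, the others frozen»): every `D₀ ∈ Ops₀ i` is the slot-`i` reading of some `Z`-preserving `D : R →ₗ[ℂ] R`: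
`D ((∏ j ∈ t, φ j (b j)) * φ i v) = (∏ j ∈ t, φ j (b j)) * φ i (D₀ v)` for finsets `t ∌ i`.
BINDER (base): every anchor pure tensor `∏ i, φ i (a i (k i))` lies in `Z`.
* §1 product bookkeeping for the mixed tensors `∏ j, φ j (if j ∈ s then r j else a j (k j))`;
* §2 **`mixed_prod_mem`** — the Finset induction; **`prod_mem_of_slotwise`** — `∏ i, φ i (r i) ∈ Z` for all `r i ∈ Rw i`; **`span_prod_le_of_slotwise`** — `⊗_w R_w ⊆ Z` as a span.
References: [LeeZhu1998, §5]; [GanQiuTakeda2014, Prop. 11]; [BorelJacquet1979, §4.1].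
HONEST LABEL: HC_CM is proved only modulo the 7 printed citations (2 remaining named inputs: hLiu418 = stmt-HodgeConjecture-24832,
h413 = stmt-HodgeConjecture-24833) until rung 0 closes; count-neutral helper, closes no socket.
-/

set_option autoImplicit false
set_option linter.dupNamespace false

namespace Summit.HodgeConjecture.HodgeConjecture.Cruxes.HLiu418.K2LiuSlotwiseSubmoduleInduction

variable {ι : Type*} [Fintype ι] [DecidableEq ι] {R : Type*} [CommRing R] [Algebra ℂ R]
variable {A : ι → Type*} [∀ i, AddCommGroup (A i)] [∀ i, Module ℂ (A i)] {κ : ι → Type*}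

/-! ## §1  Mixed products -/

omit [Algebra ℂ R] in
/-- Splitting off the slot `w`: `∏ j, f j = f w * ∏ j ∈ univ.erase w, f j`. [folklore] -/
theorem prod_eq_mul_prod_erase (f : ι → R) (w : ι) : (∏ j, f j) = f w * ∏ j ∈ Finset.univ.erase w, f j :=
  (Finset.mul_prod_erase Finset.univ f (Finset.mem_univ w)).symm

omit [Fintype ι] in
/-- Off the slot `w`, membership in `insert w s` is membership in `s`. [folklore] -/
theorem mem_insert_iff_of_ne {s : Finset ι} {w j : ι} (hj : j ≠ w) : j ∈ insert w s ↔ j ∈ s := by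
  simp [Finset.mem_insert, hj]

/-- The frozen factor of the mixed product does not see the slot `w`: replacing the anchor index at `w` leaves it unchanged. [folklore] -/
theorem prod_erase_update_eq (φ : ∀ i, A i →ₗ[ℂ] R) (a : ∀ i, κ i → A i) (s : Finset ι) (r : Π i, A i) (k : Π i, κ i) (w : ι) (k' : κ w) :
    (∏ j ∈ Finset.univ.erase w, φ j (if j ∈ s then r j else a j (Function.update k w k' j))) =
      ∏ j ∈ Finset.univ.erase w, φ j (if j ∈ s then r j else a j (k j)) :=
  Finset.prod_congr rfl fun j hj => by rw [Function.update_of_ne (Finset.ne_of_mem_erase hj)]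

/-- The frozen factor for `insert w s` equals the frozen factor for `s` (off the slot `w`). [folklore] -/
theorem prod_erase_insert_eq (φ : ∀ i, A i →ₗ[ℂ] R) (a : ∀ i, κ i → A i) (s : Finset ι) (r : Π i, A i) (k : Π i, κ i) (w : ι) :
    (∏ j ∈ Finset.univ.erase w, φ j (if j ∈ insert w s then r j else a j (k j))) =
      ∏ j ∈ Finset.univ.erase w, φ j (if j ∈ s then r j else a j (k j)) :=
  Finset.prod_congr rfl fun j hj => by
    have hj' : (j ∈ insert w s) = (j ∈ s) := propext (mem_insert_iff_of_ne (Finset.ne_of_mem_erase hj))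
    simp only [hj']

/-! ## §2  The induction -/

/-- **MIXED TENSORS LIE IN `Z`**: for every finset `s` of «freed» slots, every `r` with `r i ∈ Rw i` on `s`, and every anchor choice `k` elsewhere,
`∏ j, φ j (if j ∈ s then r j else a j (k j)) ∈ Z`. [LeeZhu1998, §5] [GanQiuTakeda2014, Prop. 11] -/
theorem mixed_prod_mem (φ : ∀ i, A i →ₗ[ℂ] R) (Ops₀ : ∀ i, Set (A i →ₗ[ℂ] A i)) (a : ∀ i, κ i → A i) (Rw : ∀ i, Submodule ℂ (A i))
    (Z : Submodule ℂ R)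
    (hslot : ∀ i, ∀ D₀ ∈ Ops₀ i, ∃ D : R →ₗ[ℂ] R, (∀ v ∈ Z, D v ∈ Z) ∧
      ∀ (t : Finset ι), i ∉ t → ∀ (b : Π j, A j) (v : A i), D ((∏ j ∈ t, φ j (b j)) * φ i v) = (∏ j ∈ t, φ j (b j)) * φ i (D₀ v))
    (hbase : ∀ k : Π i, κ i, (∏ i, φ i (a i (k i))) ∈ Z)
    (hgen : ∀ i (S : Submodule ℂ (A i)), (∀ k, a i k ∈ S) → (∀ D₀ ∈ Ops₀ i, ∀ v ∈ S, D₀ v ∈ S) → Rw i ≤ S)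
    (s : Finset ι) : ∀ (r : Π i, A i) (k : Π i, κ i), (∀ i ∈ s, r i ∈ Rw i) → (∏ j, φ j (if j ∈ s then r j else a j (k j))) ∈ Z := by
  induction s using Finset.induction_on with
  | empty =>
    intro r k _
    simpa using hbase k
  | @insert w s hw ih =>
    intro r k hr
    -- the frozen factor `c` (all slots but `w`) and the slot-`w` test submodule `S_w := {v | c * φ w v ∈ Z}`
    set c : R := ∏ j ∈ Finset.univ.erase w, φ j (if j ∈ s then r j else a j (k j)) with hc
    let S : Submodule ℂ (A w) := Z.comap ((LinearMap.mulLeft ℂ c).comp (φ w))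
    have hS_mem : ∀ v : A w, v ∈ S ↔ c * φ w v ∈ Z := fun v => Iff.rfl
    -- anchors at `w` lie in `S` (induction hypothesis with the anchor index at `w` replaced)
    have hanchor : ∀ k', a w k' ∈ S := by
      intro k'
      rw [hS_mem]
      have h := ih r (Function.update k w k') fun i hi => hr i (Finset.mem_insert_of_mem hi)
      rw [prod_eq_mul_prod_erase _ w, prod_erase_update_eq φ a s r k w k'] at h
      simpa [hw, mul_comm] using h
    -- `S` is stable under the one-place operators (slot law + `Z`-stability)
    have hstab : ∀ D₀ ∈ Ops₀ w, ∀ v ∈ S, D₀ v ∈ S := by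
      intro D₀ hD₀ v hv
      obtain ⟨D, hDZ, hD⟩ := hslot w D₀ hD₀
      rw [hS_mem] at hv ⊢
      have h := hD (Finset.univ.erase w) (Finset.notMem_erase w _) (fun j => if j ∈ s then r j else a j (k j)) v
      rw [← h]
      exact hDZ _ hv
    -- hence `Rw w ≤ S`, and the mixed product for `insert w s` is `c * φ w (r w)`
    have hle : Rw w ≤ S := hgen w S hanchor hstab
    have hrw : c * φ w (r w) ∈ Z := (hS_mem _).1 (hle (hr w (Finset.mem_insert_self w s)))
    rw [prod_eq_mul_prod_erase _ w, prod_erase_insert_eq φ a s r k w]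
    simpa [mul_comm] using hrw

/-- **`⊗_w R_w ⊆ Z` ON PURE TENSORS**: under (slot), (base), (gen), every product `∏ i, φ i (r i)` with `r i ∈ Rw i` lies in `Z`. [LeeZhu1998, §5] [GanQiuTakeda2014, Prop. 11] -/
theorem prod_mem_of_slotwise (φ : ∀ i, A i →ₗ[ℂ] R) (Ops₀ : ∀ i, Set (A i →ₗ[ℂ] A i)) (a : ∀ i, κ i → A i) (Rw : ∀ i, Submodule ℂ (A i))
    (Z : Submodule ℂ R)
    (hslot : ∀ i, ∀ D₀ ∈ Ops₀ i, ∃ D : R →ₗ[ℂ] R, (∀ v ∈ Z, D v ∈ Z) ∧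
      ∀ (t : Finset ι), i ∉ t → ∀ (b : Π j, A j) (v : A i), D ((∏ j ∈ t, φ j (b j)) * φ i v) = (∏ j ∈ t, φ j (b j)) * φ i (D₀ v))
    (hbase : ∀ k : Π i, κ i, (∏ i, φ i (a i (k i))) ∈ Z)
    (hgen : ∀ i (S : Submodule ℂ (A i)), (∀ k, a i k ∈ S) → (∀ D₀ ∈ Ops₀ i, ∀ v ∈ S, D₀ v ∈ S) → Rw i ≤ S)
    [∀ i, Nonempty (κ i)] (r : Π i, A i) (hr : ∀ i, r i ∈ Rw i) : (∏ i, φ i (r i)) ∈ Z := by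
  have h := mixed_prod_mem φ Ops₀ a Rw Z hslot hbase hgen Finset.univ r (fun i => Classical.arbitrary (κ i)) fun i _ => hr i
  simpa using h

/-- **`⊗_w R_w ⊆ Z` AS A SPAN**: the span of all such products is `≤ Z`. [LeeZhu1998, §5] [GanQiuTakeda2014, Prop. 11] -/
theorem span_prod_le_of_slotwise (φ : ∀ i, A i →ₗ[ℂ] R) (Ops₀ : ∀ i, Set (A i →ₗ[ℂ] A i)) (a : ∀ i, κ i → A i) (Rw : ∀ i, Submodule ℂ (A i))
    (Z : Submodule ℂ R)
    (hslot : ∀ i, ∀ D₀ ∈ Ops₀ i, ∃ D : R →ₗ[ℂ] R, (∀ v ∈ Z, D v ∈ Z) ∧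
      ∀ (t : Finset ι), i ∉ t → ∀ (b : Π j, A j) (v : A i), D ((∏ j ∈ t, φ j (b j)) * φ i v) = (∏ j ∈ t, φ j (b j)) * φ i (D₀ v))
    (hbase : ∀ k : Π i, κ i, (∏ i, φ i (a i (k i))) ∈ Z)
    (hgen : ∀ i (S : Submodule ℂ (A i)), (∀ k, a i k ∈ S) → (∀ D₀ ∈ Ops₀ i, ∀ v ∈ S, D₀ v ∈ S) → Rw i ≤ S)
    [∀ i, Nonempty (κ i)] :
    Submodule.span ℂ {x : R | ∃ r : Π i, A i, (∀ i, r i ∈ Rw i) ∧ x = ∏ i, φ i (r i)} ≤ Z := by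
  refine Submodule.span_le.2 ?_
  rintro x ⟨r, hr, rfl⟩
  exact prod_mem_of_slotwise φ Ops₀ a Rw Z hslot hbase hgen r hr

/-- **ONE ANCHOR PER PLACE** (special case `κ i = Unit`): base = the single anchor pure tensor `∏ i, φ i (a i)`. [LeeZhu1998, §5] -/
theorem prod_mem_of_slotwise_single (φ : ∀ i, A i →ₗ[ℂ] R) (Ops₀ : ∀ i, Set (A i →ₗ[ℂ] A i)) (a : ∀ i, A i) (Rw : ∀ i, Submodule ℂ (A i))
    (Z : Submodule ℂ R)
    (hslot : ∀ i, ∀ D₀ ∈ Ops₀ i, ∃ D : R →ₗ[ℂ] R, (∀ v ∈ Z, D v ∈ Z) ∧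
      ∀ (t : Finset ι), i ∉ t → ∀ (b : Π j, A j) (v : A i), D ((∏ j ∈ t, φ j (b j)) * φ i v) = (∏ j ∈ t, φ j (b j)) * φ i (D₀ v))
    (hbase : (∏ i, φ i (a i)) ∈ Z)
    (hgen : ∀ i (S : Submodule ℂ (A i)), a i ∈ S → (∀ D₀ ∈ Ops₀ i, ∀ v ∈ S, D₀ v ∈ S) → Rw i ≤ S)
    (r : Π i, A i) (hr : ∀ i, r i ∈ Rw i) : (∏ i, φ i (r i)) ∈ Z :=
  prod_mem_of_slotwise φ Ops₀ (fun i (_ : Unit) => a i) Rw Z hslot (fun _ => hbase) (fun i S hS hst => hgen i S (hS ()) hst) r hr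

end Summit.HodgeConjecture.HodgeConjecture.Cruxes.HLiu418.K2LiuSlotwiseSubmoduleInduction
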